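import Summits.NavierStokesRegularity.NavierStokesRegularity.Theorems.TerminalTraceTypeITraceScarL3LogMeanApexUnit
import Summits.NavierStokesRegularity.NavierStokesRegularity.Theorems.TerminalTraceTypeITraceScarL3StubExtinctApexOfL3Trace
import Literature.Analysis.FluidPDE.NSViscosityRescaling
import Literature.Analysis.FluidPDE.NSLerayHopfABCScaling
import Literature.Analysis.FluidPDE.NSLocalAnalyticityRadiusScalingTools
import HarnessLib

/-!
# T28-C «CEILING AND MEAN» AT GENERAL VISCOSITY (ROUND-28 §3; item `TerminalTrace.TypeITraceScarL3`,
# stmt-NavierStokesRegularity-18385, Stub LOUD line; helper): the ν-scaling bookkeeping of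
# `not_memLp_three_of_logMean_lt_one_unit`

Seat typer g31 of cell pub-ns-dss (cross-cell landing on DIRECTOR-NS dss_43 / nsreg #148), `--supports
stmt-NavierStokesRegularity-18385` (helper); the unit-viscosity theorem is nsreg-C26-p1 g2's
`…LogMeanApexUnit.not_memLp_three_of_logMean_lt_one_unit` (p609092); the template is the √2-window's ν-scaling file
`…ExtinctApexDOfL3TraceConst` (nsreg-C26-p1).

* **`not_memLp_three_of_logMean_lt_one`** — T28-C for viscosity `ν > 0`: a classical Leray–Hopf flow on `[0,T)`
  with an eventual Type-I rate (ANY constant `C`), NOT backward bounded at `(T, x₀)`, whose rate on a ball about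
  `x₀` has LOG-WINDOW MEANS below `2ν·q`, `q < 1` — `‖u(t,x)‖ ≤ b(t)` for `T − δ_b < t < T`, `|x − x₀| < ρ_b`,
  `b` measurable, `∫⁻_{]t',t[} b² ≤ ofReal(2qν·log((T−t')/(T−t)) + K₀)`, `K₀ ≥ 0` — has `u(T) ∉ L³(B(x₀, ρ))`
  for every `ρ > 0`.  Proof = the viscosity normalisation `v(s, x) = ν⁻¹ u(s/ν, x)` (blow-up time `νT`,
  classical at viscosity `1`, Leray–Hopf, eventual rate `(C/√ν)/√(νT − s)`, not backward bounded at `(νT, x₀)`,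
  `v(νT) = ν⁻¹ u(T) ∈ L³(B(x₀, ρ))`) exactly as in `extinctApexD_of_L3trace_const`, plus the bookkeeping of the
  new datum: `v` has the local rate `b_v(s) = ν⁻¹ b(s/ν)` on the window `(νT − νδ_b, νT)`, and the change of
  variables `τ = s/ν` gives `∫⁻_{]s',s[} b_v² = ν⁻¹ ∫⁻_{]s'/ν, s/ν[} b² ≤ ofReal(2q·log((νT−s')/(νT−s)) + K₀/ν)` —
  the log-window is scale invariant — so the unit theorem applies with `(q, K₀/ν)`.  The constant window T27-C
  (`C² < 2ν`) is the special case `b = C/√(T−t)`, `q = C²/(2ν)`, `K₀ = 0`.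

WHAT THIS IS NOT: not Stub LOUD (all rates), not item 18385 for every Type-I blow-up, NOT a proof of
Navier–Stokes regularity — a statement about hypothetical blow-ups whose rate at the singular point has
log-window means below `2ν`.  [folklore; Ghidaglia 1986; Agmon–Nirenberg 1967; AlbrittonBarker2019 §3;
SereginSverak2009 (as13); WangZhang2016 §4; Seregin2014 §6.6; CaffarelliKohnNirenberg1982]
-/

noncomputable section

set_option linter.dupNamespace false

namespace Summit.NavierStokesRegularity.NavierStokesRegularity.Theorems.TypeITraceScarL3

open MeasureTheory Set Function Filter Topology TopologicalSpace Metric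
open Literature.Analysis.FluidPDE
open scoped NNReal ENNReal InnerProductSpace RealInnerProductSpace

/-- **T28-C at viscosity `ν > 0`** (module docstring): a classical Leray–Hopf flow on `[0,T)` with an eventual
Type-I rate (ANY constant `C`), NOT backward bounded at `(T, x₀)`, whose rate on a ball about `x₀` has
log-window means `∫⁻_{]t',t[} b² ≤ ofReal(2qν·log((T−t')/(T−t)) + K₀)` with `q < 1`, `K₀ ≥ 0`, has
`u(T) ∉ L³(B(x₀, ρ))` for every `ρ > 0`.  NOT a regularity theorem: a statement about hypothetical blow-ups.
[folklore; Ghidaglia 1986; Agmon–Nirenberg 1967; CaffarelliKohnNirenberg1982 Thm B; Seregin2014 §6.6] -/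
theorem not_memLp_three_of_logMean_lt_one {ν T : ℝ} (hν : 0 < ν) (hT : 0 < T)
    {u : ℝ → EuclideanSpace ℝ (Fin 3) → EuclideanSpace ℝ (Fin 3)} {p : ℝ → EuclideanSpace ℝ (Fin 3) → ℝ}
    (hsol : IsClassicalNSSolutionOn (Ico 0 T) ν 0 u p) (hLH : IsLerayHopfOn T ν 0 (u 0) u)
    {C : ℝ} (hC0 : 0 ≤ C) (hrateT : ∀ᶠ t in 𝓝[<] T, ∀ x, ‖u t x‖ ≤ C / Real.sqrt (T - t))
    (x₀ : EuclideanSpace ℝ (Fin 3)) (hnotbd : ¬ IsBackwardBoundedAt u T x₀)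
    {b : ℝ → ℝ} (hbm : Measurable b) {δb ρb q K₀ : ℝ} (hδb : 0 < δb) (hρb : 0 < ρb) (hK₀ : 0 ≤ K₀)
    (hb : ∀ t ∈ Ioo (T - δb) T, ∀ x ∈ ball x₀ ρb, ‖u t x‖ ≤ b t)
    (hLM : ∀ t' t : ℝ, T - δb < t' → t' ≤ t → t < T →
      ∫⁻ τ in Ioo t' t, ENNReal.ofReal (b τ ^ 2) ≤
        ENNReal.ofReal (2 * q * ν * Real.log ((T - t') / (T - t)) + K₀))
    (hq : q < 1) {ρ : ℝ} (hρ : 0 < ρ) :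
    ¬ MemLp (u T) 3 (volume.restrict (ball x₀ ρ)) := by
  intro htr
  have hν0 : ν ≠ 0 := hν.ne'
  have hνi : 0 < ν⁻¹ := inv_pos.2 hν
  have hνT : 0 < ν * T := mul_pos hν hT
  -- ## viscosity normalisation `v(s, x) = ν⁻¹ u(s/ν, x)`, blow-up time `νT` (verbatim the √2-window's
  -- `extinctApexD_of_L3trace_const`)
  set v : ℝ → EuclideanSpace ℝ (Fin 3) → EuclideanSpace ℝ (Fin 3) := timeRescale ν⁻¹ ν⁻¹ u with hv
  set pv : ℝ → EuclideanSpace ℝ (Fin 3) → ℝ := timeRescale ν⁻¹ (ν⁻¹ ^ 2) p with hpv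
  have hmaps : MapsTo (fun s => ν⁻¹ * s) (Ico 0 (ν * T)) (Ico 0 T) := by
    intro s hs
    refine ⟨mul_nonneg hνi.le hs.1, ?_⟩
    calc ν⁻¹ * s < ν⁻¹ * (ν * T) := mul_lt_mul_of_pos_left hs.2 hνi
      _ = T := by rw [← mul_assoc, inv_mul_cancel₀ hν0, one_mul]
  -- (1) classical at viscosity 1 on `[0, νT)`
  have hclv : IsClassicalNSSolutionOn (Ico 0 (ν * T)) 1 0 v pv := by
    have h := hsol.viscosityRescale_set hν0 hmaps (uniqueDiffOn_Ico 0 (ν * T))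
    rwa [timeRescale_zero_force] at h
  -- (2) Leray–Hopf on `[0, νT]`
  have hv0 : ν⁻¹ • u 0 = v 0 := by
    funext x
    simp [hv]
  have hLHv : IsLerayHopfOn (ν * T) 1 0 (v 0) v := by
    have h := hLH.viscosityRescale hνi
    have e1 : T / ν⁻¹ = ν * T := by rw [div_inv_eq_mul, mul_comm]
    rwa [e1, inv_mul_cancel₀ hν0, timeRescale_zero_force, hv0] at h
  -- the pointwise size of `v`
  have hnormv : ∀ s x, ‖v s x‖ = ν⁻¹ * ‖u (ν⁻¹ * s) x‖ := by
    intro s x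
    rw [hv, timeRescale_apply, norm_smul, Real.norm_eq_abs, abs_of_pos hνi]
  -- (3) the eventual Type-I rate of `v` with constant `C/√ν`
  have e0 : ν⁻¹ * (ν * T) = T := by rw [← mul_assoc, inv_mul_cancel₀ hν0, one_mul]
  have htend : Tendsto (fun s : ℝ => ν⁻¹ * s) (𝓝[<] (ν * T)) (𝓝[<] T) := by
    refine tendsto_nhdsWithin_of_tendsto_nhds_of_eventually_within _ ?_ ?_
    · have h := ((continuous_const_mul ν⁻¹).tendsto (ν * T)).mono_left
        (nhdsWithin_le_nhds (s := Iio (ν * T)))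
      rwa [e0] at h
    · refine eventually_nhdsWithin_of_forall fun s hs => ?_
      have h := mul_lt_mul_of_pos_left (mem_Iio.1 hs) hνi
      rwa [e0] at h
  have hIv : ∀ᶠ s in 𝓝[<] (ν * T), ∀ x, ‖v s x‖ ≤ (C / Real.sqrt ν) / Real.sqrt (ν * T - s) := by
    filter_upwards [htend.eventually hrateT, self_mem_nhdsWithin] with s hs hsT x
    have hsT' : s < ν * T := hsT
    have hpos : 0 < ν * T - s := sub_pos.2 hsT'
    have e : T - ν⁻¹ * s = ν⁻¹ * (ν * T - s) := by field_simp
    have hsq : Real.sqrt (T - ν⁻¹ * s) = (Real.sqrt ν)⁻¹ * Real.sqrt (ν * T - s) := by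
      rw [e, Real.sqrt_mul hνi.le, Real.sqrt_inv]
    have hb' := hs x
    rw [hsq] at hb'
    have hsν : 0 < Real.sqrt ν := Real.sqrt_pos.2 hν
    have hsνsq : Real.sqrt ν * Real.sqrt ν = ν := Real.mul_self_sqrt hν.le
    have hsqpos : 0 < Real.sqrt (ν * T - s) := Real.sqrt_pos.2 hpos
    rw [le_div_iff₀ (by positivity)] at hb'
    have hνinv : ν⁻¹ = (Real.sqrt ν)⁻¹ * (Real.sqrt ν)⁻¹ := by rw [← mul_inv, hsνsq]
    have key : ν⁻¹ * ‖u (ν⁻¹ * s) x‖ ≤ C / Real.sqrt ν / Real.sqrt (ν * T - s) := by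
      rw [le_div_iff₀ hsqpos]
      calc ν⁻¹ * ‖u (ν⁻¹ * s) x‖ * Real.sqrt (ν * T - s)
          = (Real.sqrt ν)⁻¹ * (‖u (ν⁻¹ * s) x‖ * ((Real.sqrt ν)⁻¹ * Real.sqrt (ν * T - s))) := by
              rw [hνinv]; ring
        _ ≤ (Real.sqrt ν)⁻¹ * C := mul_le_mul_of_nonneg_left hb' (inv_nonneg.2 hsν.le)
        _ = C / Real.sqrt ν := by rw [div_eq_inv_mul]
    exact (hnormv s x) ▸ key
  have hC1 : 0 ≤ C / Real.sqrt ν := div_nonneg hC0 (Real.sqrt_nonneg _)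
  -- (4) the apex is not backward bounded for `v` either
  have hnotbdv : ¬ IsBackwardBoundedAt v (ν * T) x₀ := not_isBackwardBoundedAt_viscosityRescale hν hnotbd
  -- (5) the `L³` ball of the final value: `v(νT) = ν⁻¹ u(T)`
  have hmemv : MemLp (v (ν * T)) 3 (volume.restrict (ball x₀ ρ)) := by
    have e : v (ν * T) = fun x => ν⁻¹ • u T x := by
      funext x
      rw [hv, timeRescale_apply, ← mul_assoc, inv_mul_cancel₀ hν0, one_mul]
    rw [e]
    exact htr.const_smul ν⁻¹
  -- ## (6) the new datum: the local rate `b_v(s) = ν⁻¹ b(s/ν)` of `v` on the window `(νT − νδ_b, νT)`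
  set bv : ℝ → ℝ := fun s => ν⁻¹ * b (ν⁻¹ * s) with hbv
  have hbvm : Measurable bv := (hbm.comp (measurable_const_mul ν⁻¹)).const_mul ν⁻¹
  have hδbv : 0 < ν * δb := mul_pos hν hδb
  have hK₀v : 0 ≤ K₀ / ν := div_nonneg hK₀ hν.le
  have hwin : ∀ s, ν * T - ν * δb < s → s < ν * T → ν⁻¹ * s ∈ Ioo (T - δb) T := by
    intro s hs1 hs2
    constructor
    · have h := mul_lt_mul_of_pos_left hs1 hνi
      have e : ν⁻¹ * (ν * T - ν * δb) = T - δb := by field_simp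
      rwa [e] at h
    · have h := mul_lt_mul_of_pos_left hs2 hνi
      rwa [e0] at h
  have hbv' : ∀ s ∈ Ioo (ν * T - ν * δb) (ν * T), ∀ x ∈ ball x₀ ρb, ‖v s x‖ ≤ bv s := by
    intro s hs x hx
    rw [hnormv s x]
    exact mul_le_mul_of_nonneg_left (hb _ (hwin s hs.1 hs.2) x hx) hνi.le
  -- the log-window bound transported: `τ = s/ν`, the log-window is scale invariant
  have hLMv : ∀ s' s : ℝ, ν * T - ν * δb < s' → s' ≤ s → s < ν * T →
      ∫⁻ σ in Ioo s' s, ENNReal.ofReal (bv σ ^ 2) ≤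
        ENNReal.ofReal (2 * q * Real.log ((ν * T - s') / (ν * T - s)) + K₀ / ν) := by
    intro s' s hs' hss hsT
    have ht' : T - δb < ν⁻¹ * s' := (hwin s' hs' (lt_of_le_of_lt hss hsT)).1
    have htt : ν⁻¹ * s' ≤ ν⁻¹ * s := mul_le_mul_of_nonneg_left hss hνi.le
    have htT : ν⁻¹ * s < T := (hwin s (lt_of_lt_of_le hs' hss) hsT).2
    have hwin' := hLM (ν⁻¹ * s') (ν⁻¹ * s) ht' htt htT
    -- change of variables `σ = ν τ`
    have e1 : Ioo s' s = Ioo (ν⁻¹ * s' / ν⁻¹) (ν⁻¹ * s / ν⁻¹) := by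
      rw [mul_div_cancel_left₀ s' (inv_ne_zero hν0), mul_div_cancel_left₀ s (inv_ne_zero hν0)]
    have hcv := lintegral_Ioo_div_comp_mul hνi (ν⁻¹ * s') (ν⁻¹ * s)
      (fun τ => ENNReal.ofReal ((ν⁻¹ * b τ) ^ 2))
    rw [← e1, inv_inv] at hcv
    have hcv' : ∫⁻ σ in Ioo s' s, ENNReal.ofReal (bv σ ^ 2) =
        ENNReal.ofReal ν * ∫⁻ τ in Ioo (ν⁻¹ * s') (ν⁻¹ * s), ENNReal.ofReal ((ν⁻¹ * b τ) ^ 2) := hcv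
    -- the log-window is scale invariant
    have hlog : (T - ν⁻¹ * s') / (T - ν⁻¹ * s) = (ν * T - s') / (ν * T - s) := by
      have e2 : T - ν⁻¹ * s' = ν⁻¹ * (ν * T - s') := by field_simp
      have e3 : T - ν⁻¹ * s = ν⁻¹ * (ν * T - s) := by field_simp
      rw [e2, e3, mul_div_mul_left _ _ (inv_ne_zero hν0)]
    rw [hlog] at hwin'
    -- pull the constant `ν⁻²` out and multiply
    have e4 : ∀ τ, ENNReal.ofReal ((ν⁻¹ * b τ) ^ 2) = ENNReal.ofReal (ν⁻¹ ^ 2) * ENNReal.ofReal (b τ ^ 2) := by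
      intro τ
      rw [mul_pow, ENNReal.ofReal_mul (sq_nonneg _)]
    simp_rw [hcv', e4]
    rw [lintegral_const_mul' _ _ ENNReal.ofReal_ne_top, ← mul_assoc, ← ENNReal.ofReal_mul hν.le]
    calc ENNReal.ofReal (ν * ν⁻¹ ^ 2) * ∫⁻ τ in Ioo (ν⁻¹ * s') (ν⁻¹ * s), ENNReal.ofReal (b τ ^ 2)
        ≤ ENNReal.ofReal (ν * ν⁻¹ ^ 2) *
            ENNReal.ofReal (2 * q * ν * Real.log ((ν * T - s') / (ν * T - s)) + K₀) := by gcongr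
      _ = ENNReal.ofReal (ν * ν⁻¹ ^ 2 * (2 * q * ν * Real.log ((ν * T - s') / (ν * T - s)) + K₀)) := by
            rw [← ENNReal.ofReal_mul (by positivity)]
      _ = ENNReal.ofReal (2 * q * Real.log ((ν * T - s') / (ν * T - s)) + K₀ / ν) := by
            congr 1
            field_simp
  -- ## the unit-viscosity theorem
  exact not_memLp_three_of_logMean_lt_one_unit hνT hclv hLHv hC1 hIv x₀ hnotbdv hbvm hδbv hρb hK₀v hbv' hLMv hq hρ
    hmemv

end Summit.NavierStokesRegularity.NavierStokesRegularity.Theorems.TypeITraceScarL3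

end
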